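/-
Copyright (c) 2026 the pub-hodgecm-mathlib formalisation cell (harness21).  Prover seat hodgecm-mathlib-K2E1b-p03 (g2), Track B «K2-LIT» ∕ h413, E3 WILD CHAIN hand
(K2E3-plan (g1) DEALS BATCH #2 2026-09-03T22:15:20Z; line lead K2E3-p17): the WILD twin of E1 row 59 FILE (B) ∕ row 56-B3(59) FILE (B)-RAM.  2026-09-03.
-/
import Summits.HodgeConjecture.HodgeConjecture.Theorems.F0P3cStCharTSEPTraceOneAtDatum                 -- ★ (B) UNR (F0P3-p01 g24) p853501∕p853506: §0 `finiteDimensional_intertwiningMap_of_trivial_on` BY NAME; brings ★ 57-B, ★ F-gen2, ★ PCT-OUT, ★ EP-TRACE-ONE, ★ 48 FILE 1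
import Summits.HodgeConjecture.HodgeConjecture.Theorems.F0P3cStCharTSCharacterEllipticUniformRamified  -- ★ B2 H-RAM (LH6-p04 g11) p853513: the PLACE-FREE 41g-H §2 twins `_of_involution` ×6 + (U7) `coe_unitaryLevel_gqs_subset_mul_of_adj_of_dist_of_involution (hσ hvσ hϖ hT hfr htr₂)`
import Summits.HodgeConjecture.HodgeConjecture.Theorems.F0P3cDyRamWildPlaceDatum                       -- ★ (LH4-p02): `exists_isRamifiedQuadraticDatum_of_placesOver` (Track A U0's ramified quadratic datum at a CM place, ANY uniformiser)
import Summits.HodgeConjecture.HodgeConjecture.Theorems.F0P3cDyRamWildTransitivity                     -- ★ p854580 (LH4-p02): `htr₂_of_isRamifiedQuadraticDatum`; brings ★ htr₀-WILD p854568 `exists_unitary_mapGL_stdLattice_eq_of_isSelfDualLattice_of_ramified`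
import Literature.NumberTheory.Automorphic.UnitaryLatticeTreeEulerRelationWild                           -- ★ `isTree_latticeGraph_three_of_ramified` (the WILD tree in ★ :266's context)
import Literature.NumberTheory.Automorphic.UnitaryLatticeTreeFramesOfInvolution                          -- ★ `exists_frame_mapGL_stdLattice` (two-sided Cartan decomposition read on lattices, any isometric involution)
import HarnessLib

/-!
# K2_E3 road (h413 = stmt-HodgeConjecture-24833), unit U5Kazhdan — THE WILD ENGINE, FILE «59-W»: EP TRACE ONE `tr σ(f_EP) = 1` and EP-NORM-ONE `⟨χ_σ, χ_σ⟩_e = 1`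
# (modulo `hpc`) on the `U(Φ₃)(L⁺_v)` tree AT EVERY RAMIFIED PLACE `w ∣ v` — tame re-proved, WILD (dyadic, `|2|_w < 1`) new — Schneider–Stuhler 1997 §III.4; Kottwitz 1988 §2;
# Rogawski 1990 §12.6

Cell `pub/hodgecm-mathlib` (D-0151), Track B; crux H413 = `stmt-HodgeConjecture-24833`; lane `--kind proof --supports stmt-HodgeConjecture-24833 --as helper` (THEOREMS ONLY: no
definition ∕ instance ∕ notation ∕ named fact ∕ `sorry`; ★-only imports, never a `Cruxes/…/Lines` module; count-neutral: closes no node).  Namespace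
`Summit.HodgeConjecture.HodgeConjecture.Cruxes.H413.K2E3EPTraceOneAtDatumWild`.  Seat K2E1b-p03 (g2) (E3 WILD CHAIN hand; K2E3-plan (g1) BATCH #2; line lead K2E3-p17 (g0)).

WHAT.  ★ row 59 FILE (B) `F0P3cStCharTSEPTraceOneAtDatum` (UNRAMIFIED datum `hd`) and its TAME twin ★ `F0P3cStCharTSEPTraceOneAtDatumRamified` (`_of_neg`: seven letters
`hσ hvσ hϖ hσϖ hres h2 hnorm`, so `|2|_w = 1`) give the two datum heads «EP TRACE ONE» and «EP-NORM-ONE modulo `hpc`».  THIS FILE re-issues both heads AT EVERY RAMIFIED PLACE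
`w ∣ v` (`he : e(w∣v) ≠ 1`), ANY uniformiser `ϖ` (`hϖ : |ϖ|_w = q_w⁻¹`), with NO hypothesis on `|2|_w` — so at the WILD (dyadic) places too — by the single binder substitution of the
wild engine's mechanical layer (★ `K2E3EPFunctionGRamifiedExplicit` p855067 ∕ `K2E3EPFunctionOrbitalOrbitsWild` convention): tame block `(hσ hvσ hϖ hσϖ hres h2 hnorm)` ↦ `(he) (hϖ)` +
`obtain ⟨d, t, hD⟩ := exists_isRamifiedQuadraticDatum_of_placesOver …` inside; names `…_of_ramificationIdx_ne_one`; conclusions VERBATIM (the fixed-vector letter is spelled `hx₀`,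
as in the consumer ★ (C)-RAM, because `he` now names the ramification letter).  The place-sensitive inputs are exactly two: the TREE — ★ `isTree_latticeGraph_three_of_ramified`
(htr₀-WILD ★ p854568 + htr₂-WILD ★ p854569, [Jacobowitz1962]) — and (U7) — ★ H-RAM's PLACE-FREE `coe_unitaryLevel_gqs_subset_mul_of_adj_of_dist_of_involution (hσ hvσ hϖ hT hfr htr₂)` with
`hfr` := ★ htr₀-WILD ∘ ★ `exists_frame_mapGL_stdLattice` and `htr₂` := ★ `htr₂_of_isRamifiedQuadraticDatum`; the six other 41g-H §2 reads are ★ H-RAM's `_of_involution` twins, which only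
read `hσ hvσ hϖ`.  Everything else (★ 57-B bridges, ★ F-gen2 presentation, admissible Schur, ★ EP-TRACE-ONE ED. 2, ★ PCT-OUT) is place-free and used BY NAME.
* §1-W **`smoothTrace_epTwoFamilies_eq_one_at_datum_of_ramificationIdx_ne_one`** — THE TRACE SIDE at the datum, every ramified `w`.
* §1-W **`innerG_char_self_eq_one_of_isPseudoCoeff_epTwoFamilies_of_ramificationIdx_ne_one`** — THE NORM `⟨χ_σ, χ_σ⟩_e = 1` modulo `hpc`, every ramified `w`.
Consumers: the wild organ heads W₁ `sig_K2E3EPNormOneWild` (★73-W) and, through the PAIR twin `K2E3EPTracePairAtDatumWild`, W₂ `sig_K2E3InnerGCharCrossEqZeroWild` (X0′-W).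
HONEST RESIDUE (named, not papered over): the pseudo-coefficient binder `hpc` stays; its WILD supplier is the wild twin of row 58 (58-W-W), outside this file.
HONEST LABEL: HC_CM is proved only modulo the 7 printed citations (2 remaining named inputs: hLiu418 = stmt-HodgeConjecture-24832, h413 = stmt-HodgeConjecture-24833) until rung 0
closes; `--supports stmt-HodgeConjecture-24833` helper (a brick of the wild residue of rows #15–#18); retires nothing by itself; nothing printed is asserted here.

## References
* [SchneiderStuhler1997] P. Schneider, U. Stuhler, *Representation theory and sheaves on the Bruhat–Tits building*, Publ. Math. IHÉS 85 (1997): Thm. II.3.1, §III.4.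
* [Kottwitz1988] R. E. Kottwitz, *Tamagawa numbers*, Ann. of Math. 127 (1988): §2 (the Euler–Poincaré function).
* [Rogawski1990] J. D. Rogawski, *Automorphic Representations of Unitary Groups in Three Variables*, Ann. of Math. Stud. 123 (1990): §12.5 pp. 182–187, §12.6 Prop. 12.6.1 (a) p. 188.
* [BruhatTits1972] F. Bruhat, J. Tits, *Groupes réductifs sur un corps local* I, Publ. Math. IHÉS 41 (1972): §10 (the tree of `U(3)`, every place).
* [Jacobowitz1962] R. Jacobowitz, *Hermitian forms over local fields*, Amer. J. Math. 84 (1962): §§9–11, §10 Prop. 10.3 (unimodular hermitian lattices over a ramified dyadic extension).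
-/

set_option autoImplicit false

set_option linter.dupNamespace false

noncomputable section

open NumberField IsDedekindDomain MeasureTheory Measure Filter Topology
open scoped Pointwise Valued WithZero Matrix MatrixGroups BigOperators
open Literature.NumberTheory.Rogawski1990 Literature.NumberTheory.Rogawski1990.Ch12Sec5
open Literature.NumberTheory.Automorphic Literature.NumberTheory.Automorphic.UnitaryGroup Literature.NumberTheory.Automorphic.UnitaryLatticeTree
open Literature.NumberTheory.Automorphic.HermitianLattice Literature.NumberTheory.GaloisRepresentations
open Literature.Combinatorics.SimpleGraph Literature.Combinatorics.SimpleGraph.OrientedIncidence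

namespace Summit.HodgeConjecture.HodgeConjecture.Cruxes.H413.K2E3EPTraceOneAtDatumWild

open Summit.HodgeConjecture.HodgeConjecture.Cruxes.H413
open Summit.HodgeConjecture.HodgeConjecture.Cruxes.H413.F0P3cStCharTSCharacterEllipticUniform
open Summit.HodgeConjecture.HodgeConjecture.Cruxes.H413.F0P3cStCharTSCharacterEllipticUniformRamified
open Summit.HodgeConjecture.HodgeConjecture.Cruxes.H413.F0P3cStCharTSEPFunctionOrbitalOrbits
open Summit.HodgeConjecture.HodgeConjecture.Cruxes.H413.F0P3cStCharTSEPTraceOneAtDatum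
open Summit.HodgeConjecture.HodgeConjecture.Cruxes.H413.F0P3cDyRamWildPlaceDatum
open Summit.HodgeConjecture.HodgeConjecture.Cruxes.H413.F0P3cDyRamWildTransitivity

/-! ## §1-W THE TRACE SIDE at the datum at ANY ramified place (wild dyadic places included) -/

section Head

variable (L : Type) [Field L] [NumberField L] [IsCMField L] (v : HeightOneSpectrum (𝓞 ↥(maximalRealSubfield L)))

set_option maxHeartbeats 1600000 in
/-- **EP TRACE ONE AT THE DATUM at ANY RAMIFIED place `w ∣ v` (`e(w∣v) ≠ 1` — TAME, RAMIFIED-PRIME AND RAMIFIED-UNIT (WILD, DYADIC) ALIKE) —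
`tr σ(Σ_i μ(P₀ i)⁻¹ f₀ i − Σ_j μ(P₁ j)⁻¹ f₁ j) = 1`** (twin of ★ `smoothTrace_epTwoFamilies_eq_one_at_datum` ∕ ★ `…_of_neg`: the datum slot holds the two letters
`(he : e(w∣v) ≠ 1) (hϖ : |ϖ|_w = q_w⁻¹)`, ANY uniformiser `ϖ`, NO hypothesis on `|2|_w` or on `σ_w ϖ`; conclusion and every other binder VERBATIM, the fixed-vector letter spelled `hx₀`).
For the action hom `a` and the unitary level family `U` at level `ϖ^(e+1)` (★ 41g-H, hypothesis-style `ha hU`), a Haar measure `νQv`, an invariant orientation `τ` of the tree, an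
irreducible smooth `r : SmoothIrrep (Gqs L v)` with `r.ρ.fixedPoints (U x₀) ≠ ⊥`, ORBIT DATA for vertices (`ι₀`, `xv idx₀ tr₀ P₀ σ₀`) and edges (`ι₁`, `xe idx₁ tr₁ P₁ σ₁`)
in ★ 57-B's letters, `K`-type pieces `f₀ ∕ f₁` in ★ 42's letters, and `hsplit` (every smooth self-extension of `r.ρ` splits):
`r.ρ.smoothTrace νQv ((∑ i, (νQv.real (P₀ i))⁻¹ • f₀ i) − ∑ j, (νQv.real (P₁ j))⁻¹ • f₁ j) = 1`.
PROOF = ★'s, reading the tree letters at Track A U0's RAMIFIED QUADRATIC DATUM `IsRamifiedQuadraticDatum σ_w ϖ d t` (★ `exists_isRamifiedQuadraticDatum_of_placesOver`): the tree is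
★ `isTree_latticeGraph_three_of_ramified`, the (U7) letters `hfr`∕`htr₂` of ★ H-RAM's PLACE-FREE `coe_unitaryLevel_gqs_subset_mul_of_adj_of_dist_of_involution` are ★ htr₀-WILD
`exists_unitary_mapGL_stdLattice_eq_of_isSelfDualLattice_of_ramified` + ★ `exists_frame_mapGL_stdLattice` and ★ `htr₂_of_isRamifiedQuadraticDatum`; the six other 41g-H §2 reads are
★ H-RAM's `_of_involution` twins (`hσ hvσ hϖ` only).
[cite: SchneiderStuhler1997, §III.4] [cite: Kottwitz1988, §2] [cite: Rogawski1990, §12.6 Prop. 12.6.1 (a) p. 188] [cite: BruhatTits1972, §10] [cite: Jacobowitz1962, §10 Prop. 10.3] -/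
theorem smoothTrace_epTwoFamilies_eq_one_at_datum_of_ramificationIdx_ne_one
    (hns : ∀ w : PlacesOver L v, IsCMField.complexConj L • w.1 = w.1)
    (w : PlacesOver L v) (hw : IsCMField.complexConj L • w.1 = w.1) {ϖ : (w.1.adicCompletion L)}
    (he : v.asIdeal.ramificationIdx' w.1.asIdeal ≠ 1) (hϖ : Valued.v ϖ = WithZero.exp (-1 : ℤ))
    (eA : (Gqs L v) ≃ₜ* ↥(unitaryGroupOfForm (galAdicCompletionMap (L := L) (IsCMField.complexConj L) hw) ((StdForm.antidiagonal 3).over (w.1.adicCompletion L))))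
    {a : (Gqs L v) →* ((latticeGraph (galAdicCompletionMap (L := L) (IsCMField.complexConj L) hw) ϖ ((StdForm.antidiagonal 3).over (w.1.adicCompletion L))) ≃g (latticeGraph (galAdicCompletionMap (L := L) (IsCMField.complexConj L) hw) ϖ ((StdForm.antidiagonal 3).over (w.1.adicCompletion L))))} (ha : ∀ g, a g = latticeGraphIso (galAdicCompletionMap (L := L) (IsCMField.complexConj L) hw) ϖ ((StdForm.antidiagonal 3).over (w.1.adicCompletion L)) (eA g))
    [MeasurableSpace (Gqs L v)] [BorelSpace (Gqs L v)]
    (νQv : Measure (Gqs L v)) [νQv.IsHaarMeasure]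
    (τ : Orientation (latticeGraph (galAdicCompletionMap (L := L) (IsCMField.complexConj L) hw) ϖ ((StdForm.antidiagonal 3).over (w.1.adicCompletion L)))) (hτ : ∀ d, τ.tail d < τ.head d)
    {e : ℕ} {U : {M : Submodule 𝒪[(w.1.adicCompletion L)] (Fin 3 → (w.1.adicCompletion L)) // IsVertex (galAdicCompletionMap (L := L) (IsCMField.complexConj L) hw) ϖ ((StdForm.antidiagonal 3).over (w.1.adicCompletion L)) M} → Subgroup (Gqs L v)}
    (hU : ∀ x g, g ∈ U x ↔ mapGL ((eA g : ↥(unitaryGroupOfForm (galAdicCompletionMap (L := L) (IsCMField.complexConj L) hw) ((StdForm.antidiagonal 3).over (w.1.adicCompletion L)))) : GL (Fin 3) (w.1.adicCompletion L)) x.1 = x.1 ∧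
      x.1.map ((Matrix.toLin' ((((eA g : ↥(unitaryGroupOfForm (galAdicCompletionMap (L := L) (IsCMField.complexConj L) hw) ((StdForm.antidiagonal 3).over (w.1.adicCompletion L)))) : GL (Fin 3) (w.1.adicCompletion L)) : Matrix (Fin 3) (Fin 3) (w.1.adicCompletion L)) - 1)).restrictScalars 𝒪[(w.1.adicCompletion L)]) ≤ scaleLattice (ϖ ^ (e + 1)) x.1)
    (r : SmoothIrrep (Gqs L v)) {x₀ : {M : Submodule 𝒪[(w.1.adicCompletion L)] (Fin 3 → (w.1.adicCompletion L)) // IsVertex (galAdicCompletionMap (L := L) (IsCMField.complexConj L) hw) ϖ ((StdForm.antidiagonal 3).over (w.1.adicCompletion L)) M}} (hx₀ : r.ρ.fixedPoints (U x₀) ≠ ⊥)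
    -- vertex orbit data (★ 57-B letters)
    {ι₀ : Type} [Fintype ι₀] [DecidableEq ι₀] (xv : ι₀ → {M : Submodule 𝒪[(w.1.adicCompletion L)] (Fin 3 → (w.1.adicCompletion L)) // IsVertex (galAdicCompletionMap (L := L) (IsCMField.complexConj L) hw) ϖ ((StdForm.antidiagonal 3).over (w.1.adicCompletion L)) M}) (idx₀ : {M : Submodule 𝒪[(w.1.adicCompletion L)] (Fin 3 → (w.1.adicCompletion L)) // IsVertex (galAdicCompletionMap (L := L) (IsCMField.complexConj L) hw) ϖ ((StdForm.antidiagonal 3).over (w.1.adicCompletion L)) M} → ι₀) (tr₀ : {M : Submodule 𝒪[(w.1.adicCompletion L)] (Fin 3 → (w.1.adicCompletion L)) // IsVertex (galAdicCompletionMap (L := L) (IsCMField.complexConj L) hw) ϖ ((StdForm.antidiagonal 3).over (w.1.adicCompletion L)) M} → Gqs L v)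
    (hidx₀ : ∀ i, idx₀ (xv i) = i) (hidx₀a : ∀ (g : Gqs L v) (x : {M : Submodule 𝒪[(w.1.adicCompletion L)] (Fin 3 → (w.1.adicCompletion L)) // IsVertex (galAdicCompletionMap (L := L) (IsCMField.complexConj L) hw) ϖ ((StdForm.antidiagonal 3).over (w.1.adicCompletion L)) M}), idx₀ (a g x) = idx₀ x) (htr₀ : ∀ x, a (tr₀ x) (xv (idx₀ x)) = x)
    (P₀ : ι₀ → Subgroup (Gqs L v)) (hP₀ : ∀ i g, g ∈ P₀ i ↔ a g (xv i) = xv i)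
    (σ₀ : ∀ i, Representation ℂ ↥(P₀ i) ↥(r.ρ.fixedPoints (U (xv i))))
    (hσ₀ : ∀ (i : ι₀) (p : ↥(P₀ i)) (x : ↥(r.ρ.fixedPoints (U (xv i)))), ((σ₀ i p x : ↥(r.ρ.fixedPoints (U (xv i)))) : r.V) = r.ρ (p : Gqs L v) (x : r.V))
    -- edge orbit data (★ 57-B letters)
    {ι₁ : Type} [Fintype ι₁] [DecidableEq ι₁] (xe : ι₁ → (latticeGraph (galAdicCompletionMap (L := L) (IsCMField.complexConj L) hw) ϖ ((StdForm.antidiagonal 3).over (w.1.adicCompletion L))).edgeSet) (idx₁ : (latticeGraph (galAdicCompletionMap (L := L) (IsCMField.complexConj L) hw) ϖ ((StdForm.antidiagonal 3).over (w.1.adicCompletion L))).edgeSet → ι₁) (tr₁ : (latticeGraph (galAdicCompletionMap (L := L) (IsCMField.complexConj L) hw) ϖ ((StdForm.antidiagonal 3).over (w.1.adicCompletion L))).edgeSet → Gqs L v)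
    (hidx₁ : ∀ j, idx₁ (xe j) = j) (hidx₁a : ∀ (g : Gqs L v) (d : (latticeGraph (galAdicCompletionMap (L := L) (IsCMField.complexConj L) hw) ϖ ((StdForm.antidiagonal 3).over (w.1.adicCompletion L))).edgeSet), idx₁ ((a g).mapEdgeSet d) = idx₁ d)
    (htr₁ : ∀ d : (latticeGraph (galAdicCompletionMap (L := L) (IsCMField.complexConj L) hw) ϖ ((StdForm.antidiagonal 3).over (w.1.adicCompletion L))).edgeSet, (a (tr₁ d)).mapEdgeSet (xe (idx₁ d)) = d)
    (P₁ : ι₁ → Subgroup (Gqs L v)) (hP₁ : ∀ j g, g ∈ P₁ j ↔ (a g).mapEdgeSet (xe j) = xe j)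
    (σ₁ : ∀ j, Representation ℂ ↥(P₁ j) ↥(r.ρ.fixedPoints (U (τ.head (xe j)) ⊔ U (τ.tail (xe j)))))
    (hσ₁ : ∀ (j : ι₁) (p : ↥(P₁ j)) (x : ↥(r.ρ.fixedPoints (U (τ.head (xe j)) ⊔ U (τ.tail (xe j))))),
      ((σ₁ j p x : ↥(r.ρ.fixedPoints (U (τ.head (xe j)) ⊔ U (τ.tail (xe j))))) : r.V) = r.ρ (p : Gqs L v) (x : r.V))
    -- the `K`-type pieces (★ 42 letters)
    {f₀ : ι₀ → Gqs L v → ℂ} (hfP₀ : ∀ i (g : Gqs L v) (hg : g ∈ P₀ i), f₀ i g = (σ₀ i).character ⟨g, hg⟩⁻¹) (hf0₀ : ∀ i, ∀ g ∉ P₀ i, f₀ i g = 0)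
    {f₁ : ι₁ → Gqs L v → ℂ} (hfP₁ : ∀ j (g : Gqs L v) (hg : g ∈ P₁ j), f₁ j g = (σ₁ j).character ⟨g, hg⟩⁻¹) (hf0₁ : ∀ j, ∀ g ∉ P₁ j, f₁ j g = 0)
    -- every SMOOTH self-extension of `σ` splits (★ 40″ ∕ ★ 46″ at the families)
    (hsplit : ∀ (E : Type) [AddCommGroup E] [Module ℂ E] (ρE : Representation ℂ (Gqs L v) E), ρE.IsSmooth →
      ∀ (i : r.ρ.IntertwiningMap ρE) (p : ρE.IntertwiningMap r.ρ), Function.Injective i → LinearMap.ker p.toLinearMap = LinearMap.range i.toLinearMap →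
        Function.Surjective p → ∃ s : r.ρ.IntertwiningMap ρE, p.comp s = Representation.IntertwiningMap.id r.ρ) :
    r.ρ.smoothTrace νQv ((∑ i, ((νQv.real (P₀ i : Set (Gqs L v)) : ℂ))⁻¹ • f₀ i) - ∑ j, ((νQv.real (P₁ j : Set (Gqs L v)) : ℂ))⁻¹ • f₁ j) = 1 := by
  classical
  haveI : r.ρ.IsIrreducible := r.isIrreducible
  haveI : Nontrivial r.V := Representation.IsIrreducible.nontrivial r.ρ
  haveI : NonarchimedeanGroup (Gqs L v) :=
    nonarchimedeanGroup_unitaryGroupOfForm_local (E := L) (c := IsCMField.complexConj L) (N := 3) (v := v) (J' := (adelicForm L 3 (qsForm L)).map (adeleToLocal L v))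
  have hadm : r.ρ.IsAdmissible := F0P3cStCharTSScTracePackage.isAdmissible_smoothIrrep L v hns r
  have hρ : r.ρ.IsSmooth := r.isSmooth
  -- the RAMIFIED QUADRATIC DATUM at `w` (★ U0 dress, ANY uniformiser; tame ∕ R-P ∕ R-U alike — no `|2|_w = 1`, no `σ_w ϖ = −ϖ`)
  letI : Fintype 𝓀[w.1.adicCompletion L] := Fintype.ofFinite _
  obtain ⟨nd, nt, hD⟩ := exists_isRamifiedQuadraticDatum_of_placesOver L w hw he ϖ hϖ
  have htr₂ := htr₂_of_isRamifiedQuadraticDatum hD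
  obtain ⟨hσ, hvσ, -, heven, hd, h1d, h2t⟩ := hD
  -- the tree letters at the datum: the WILD tree (★ `isTree_latticeGraph_three_of_ramified`) and the self-dual frames (★ htr₀-WILD + ★ two-sided Cartan on lattices)
  have hT := isTree_latticeGraph_three_of_ramified hσ hvσ hϖ heven hd h1d h2t
  have hfr : ∀ M : Submodule 𝒪[(w.1.adicCompletion L)] (Fin 3 → (w.1.adicCompletion L)), IsSelfDualLattice (galAdicCompletionMap (L := L) (IsCMField.complexConj L) hw) ϖ ((StdForm.antidiagonal 3).over (w.1.adicCompletion L)) M →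
      ∃ k : unitaryGroupOfForm (galAdicCompletionMap (L := L) (IsCMField.complexConj L) hw) ((StdForm.antidiagonal 3).over (w.1.adicCompletion L)), k ∈ unitaryInt (galAdicCompletionMap (L := L) (IsCMField.complexConj L) hw) ((StdForm.antidiagonal 3).over (w.1.adicCompletion L)) ∧
        ∃ n : ℤ, M = mapGL (k : GL (Fin 3) (w.1.adicCompletion L)) (latt (Matrix.diagonal ![ϖ ^ n, 1, ϖ ^ (-n)])) := fun M hM => by
    obtain ⟨u, hu⟩ := exists_unitary_mapGL_stdLattice_eq_of_isSelfDualLattice_of_ramified hσ hvσ hϖ heven hd h1d h2t M hM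
    obtain ⟨κ, hκ, n, hn⟩ := exists_frame_mapGL_stdLattice hσ hvσ hϖ u
    exact ⟨κ, hκ, n, by rw [hu, hn]⟩
  have hstab := fun x : {M : Submodule 𝒪[(w.1.adicCompletion L)] (Fin 3 → (w.1.adicCompletion L)) // IsVertex (galAdicCompletionMap (L := L) (IsCMField.complexConj L) hw) ϖ ((StdForm.antidiagonal 3).over (w.1.adicCompletion L)) M} => isOpen_setOf_actionHom_apply_eq (eA := eA) ha x
  have hUo := fun x : {M : Submodule 𝒪[(w.1.adicCompletion L)] (Fin 3 → (w.1.adicCompletion L)) // IsVertex (galAdicCompletionMap (L := L) (IsCMField.complexConj L) hw) ϖ ((StdForm.antidiagonal 3).over (w.1.adicCompletion L)) M} => isOpen_coe_unitaryLevel_gqs_of_involution (eA := eA) hU hϖ x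
  have hUc := fun x : {M : Submodule 𝒪[(w.1.adicCompletion L)] (Fin 3 → (w.1.adicCompletion L)) // IsVertex (galAdicCompletionMap (L := L) (IsCMField.complexConj L) hw) ϖ ((StdForm.antidiagonal 3).over (w.1.adicCompletion L)) M} => isCompact_coe_unitaryLevel_gqs_of_involution (eA := eA) hU hϖ x
  have hU6 : ∀ x y : {M : Submodule 𝒪[(w.1.adicCompletion L)] (Fin 3 → (w.1.adicCompletion L)) // IsVertex (galAdicCompletionMap (L := L) (IsCMField.complexConj L) hw) ϖ ((StdForm.antidiagonal 3).over (w.1.adicCompletion L)) M}, (latticeGraph (galAdicCompletionMap (L := L) (IsCMField.complexConj L) hw) ϖ ((StdForm.antidiagonal 3).over (w.1.adicCompletion L))).Adj x y → ((U x ⊔ U y : Subgroup (Gqs L v)) : Set (Gqs L v)) = (U x : Set (Gqs L v)) * (U y : Set (Gqs L v)) :=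
    fun x y hxy => coe_sup_unitaryLevel_gqs_eq_mul_of_adj_of_involution (eA := eA) hU hvσ hϖ hxy
  have hU7 : ∀ x y z : {M : Submodule 𝒪[(w.1.adicCompletion L)] (Fin 3 → (w.1.adicCompletion L)) // IsVertex (galAdicCompletionMap (L := L) (IsCMField.complexConj L) hw) ϖ ((StdForm.antidiagonal 3).over (w.1.adicCompletion L)) M}, (latticeGraph (galAdicCompletionMap (L := L) (IsCMField.complexConj L) hw) ϖ ((StdForm.antidiagonal 3).over (w.1.adicCompletion L))).Adj x y → (latticeGraph (galAdicCompletionMap (L := L) (IsCMField.complexConj L) hw) ϖ ((StdForm.antidiagonal 3).over (w.1.adicCompletion L))).dist y z + 1 = (latticeGraph (galAdicCompletionMap (L := L) (IsCMField.complexConj L) hw) ϖ ((StdForm.antidiagonal 3).over (w.1.adicCompletion L))).dist x z →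
      ((U y : Subgroup (Gqs L v)) : Set (Gqs L v)) ⊆ (U x : Set (Gqs L v)) * (U z : Set (Gqs L v)) :=
    fun x y z hxy hyz => coe_unitaryLevel_gqs_subset_mul_of_adj_of_dist_of_involution (eA := eA) hU hσ hvσ hϖ hT hfr htr₂ hxy hyz
  have hUa := fun (g : Gqs L v) (x : {M : Submodule 𝒪[(w.1.adicCompletion L)] (Fin 3 → (w.1.adicCompletion L)) // IsVertex (galAdicCompletionMap (L := L) (IsCMField.complexConj L) hw) ϖ ((StdForm.antidiagonal 3).over (w.1.adicCompletion L)) M}) => unitaryLevel_gqs_actionHom_eq_map_conj (eA := eA) ha hU g x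
  have hσa : ∀ (g : Gqs L v) (d : (latticeGraph (galAdicCompletionMap (L := L) (IsCMField.complexConj L) hw) ϖ ((StdForm.antidiagonal 3).over (w.1.adicCompletion L))).edgeSet), τ.head ((a g).mapEdgeSet d) = a g (τ.head d) ∧ τ.tail ((a g).mapEdgeSet d) = a g (τ.tail d) := fun g d => by
    rw [ha]; exact head_mapEdgeSet_latticeGraphIso (galAdicCompletionMap (L := L) (IsCMField.complexConj L) hw) ϖ ((StdForm.antidiagonal 3).over (w.1.adicCompletion L)) hτ (eA g) d
  -- the chain representations (★ 41d-II, ★ 5a)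
  obtain ⟨τc, hτc⟩ := Representation.exists_rep_zeroChains (ι := {M : Submodule 𝒪[(w.1.adicCompletion L)] (Fin 3 → (w.1.adicCompletion L)) // IsVertex (galAdicCompletionMap (L := L) (IsCMField.complexConj L) hw) ϖ ((StdForm.antidiagonal 3).over (w.1.adicCompletion L)) M}) (G := (latticeGraph (galAdicCompletionMap (L := L) (IsCMField.complexConj L) hw) ϖ ((StdForm.antidiagonal 3).over (w.1.adicCompletion L)))) a r.ρ
  obtain ⟨τ₁c, hτ₁c⟩ := Representation.exists_rep_oneChains (G := (latticeGraph (galAdicCompletionMap (L := L) (IsCMField.complexConj L) hw) ϖ ((StdForm.antidiagonal 3).over (w.1.adicCompletion L)))) a r.ρ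
  obtain ⟨ρ₁, ρ₀, -, hρ₁, hρ₀, -⟩ := Representation.exists_reps_univ (ρ := r.ρ) hτc hτ₁c τ U hUa hσa
  -- stabilisers: `U ≤ P ≤ N(U)`, openness, compactness; the local representations are trivial on the levels and smooth
  have hUP₀ : ∀ i, U (xv i) ≤ P₀ i := fun i g hg => (hP₀ i g).2 (actionHom_apply_eq_of_mem (eA := eA) ha hU hg)
  have hPU₀ : ∀ i, P₀ i ≤ Subgroup.normalizer (U (xv i) : Set (Gqs L v)) := fun i g hg => mem_normalizer_unitaryLevel_gqs_of_apply_eq (eA := eA) ha hU ((hP₀ i g).1 hg)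
  have hP₀o : ∀ i, IsOpen (P₀ i : Set (Gqs L v)) := fun i => Representation.isOpen_of_forall_mem_iff_apply_eq hstab (hP₀ i)
  have hP₀c : ∀ i, IsCompact (P₀ i : Set (Gqs L v)) := fun i => by
    have hset : (P₀ i : Set (Gqs L v)) = {g : Gqs L v | a g (xv i) = xv i} := Set.ext fun g => hP₀ i g
    rw [hset]; exact isCompact_setOf_actionHom_apply_eq L v w hw eA ha (xv i)
  have hτ₀ : ∀ i (p : ↥(P₀ i)), (p : Gqs L v) ∈ U (xv i) → σ₀ i p = 1 := fun i p hp => by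
    refine LinearMap.ext fun x => Subtype.ext ?_
    rw [hσ₀, Module.End.one_apply]
    exact (Representation.mem_fixedPoints _ _ _).1 x.2 _ hp
  have hEadj : ∀ j, (latticeGraph (galAdicCompletionMap (L := L) (IsCMField.complexConj L) hw) ϖ ((StdForm.antidiagonal 3).over (w.1.adicCompletion L))).Adj (τ.head (xe j)) (τ.tail (xe j)) := fun j => τ.adj_head_tail (xe j)
  have hUP₁ : ∀ j, U (τ.head (xe j)) ⊔ U (τ.tail (xe j)) ≤ P₁ j := fun j g hg => by
    rw [hP₁, mapEdgeSet_eq_iff L v w hw eA ha τ hτ]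
    have hg' : g ∈ ((U (τ.head (xe j)) : Set (Gqs L v)) * (U (τ.tail (xe j)) : Set (Gqs L v))) := by
      rw [← hU6 _ _ (hEadj j)]; exact hg
    obtain ⟨u, hu, u', hu', rfl⟩ := hg'
    refine ⟨?_, ?_⟩
    · rw [map_mul, RelIso.coe_mul, Function.comp_apply, actionHom_apply_eq_of_mem_of_adj_of_involution (eA := eA) ha hU hvσ hϖ hu' (hEadj j).symm,
        actionHom_apply_eq_of_mem (eA := eA) ha hU hu]
    · rw [map_mul, RelIso.coe_mul, Function.comp_apply, actionHom_apply_eq_of_mem (eA := eA) ha hU hu',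
        actionHom_apply_eq_of_mem_of_adj_of_involution (eA := eA) ha hU hvσ hϖ hu (hEadj j)]
  have hPU₁ : ∀ j, P₁ j ≤ Subgroup.normalizer ((U (τ.head (xe j)) ⊔ U (τ.tail (xe j)) : Subgroup (Gqs L v)) : Set (Gqs L v)) := fun j g hg => by
    have hg' := ((mapEdgeSet_eq_iff L v w hw eA ha τ hτ g (xe j)).1 ((hP₁ j g).1 hg))
    exact mem_normalizer_sup_of_mem (mem_normalizer_unitaryLevel_gqs_of_apply_eq (eA := eA) ha hU hg'.1)
      (mem_normalizer_unitaryLevel_gqs_of_apply_eq (eA := eA) ha hU hg'.2)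
  have hP₁o : ∀ j, IsOpen (P₁ j : Set (Gqs L v)) := fun j => Representation.isOpen_of_forall_mem_iff_mapEdgeSet_eq hstab τ (hP₁ j)
  have hP₁c : ∀ j, IsCompact (P₁ j : Set (Gqs L v)) := fun j => by
    refine (isCompact_setOf_actionHom_apply_eq L v w hw eA ha (τ.head (xe j))).of_isClosed_subset ((P₁ j).isClosed_of_isOpen (hP₁o j)) ?_
    intro g hg
    exact ((mapEdgeSet_eq_iff L v w hw eA ha τ hτ g (xe j)).1 ((hP₁ j g).1 hg)).1
  have hEo : ∀ j, IsOpen ((U (τ.head (xe j)) ⊔ U (τ.tail (xe j)) : Subgroup (Gqs L v)) : Set (Gqs L v)) := fun j => isOpen_coe_sup_unitaryLevel_gqs_of_involution (eA := eA) hU hϖ _ _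
  have hEc : ∀ j, IsCompact ((U (τ.head (xe j)) ⊔ U (τ.tail (xe j)) : Subgroup (Gqs L v)) : Set (Gqs L v)) := fun j =>
    isCompact_coe_sup_unitaryLevel_gqs_of_adj_of_involution (eA := eA) hU hvσ hϖ (hEadj j)
  have hτ₁ : ∀ j (p : ↥(P₁ j)), (p : Gqs L v) ∈ U (τ.head (xe j)) ⊔ U (τ.tail (xe j)) → σ₁ j p = 1 := fun j p hp => by
    refine LinearMap.ext fun x => Subtype.ext ?_
    rw [hσ₁, Module.End.one_apply]
    exact (Representation.mem_fixedPoints _ _ _).1 x.2 _ hp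
  -- the local Hom-spaces are finite-dimensional (admissibility + §0)
  haveI : ∀ i, FiniteDimensional ℂ ↥(r.ρ.fixedPoints (U (xv i))) := fun i => hadm.finite_fixedPoints ⟨U (xv i), hUo (xv i)⟩ (hUc (xv i))
  haveI : ∀ j, FiniteDimensional ℂ ↥(r.ρ.fixedPoints (U (τ.head (xe j)) ⊔ U (τ.tail (xe j)))) := fun j =>
    hadm.finite_fixedPoints ⟨U (τ.head (xe j)) ⊔ U (τ.tail (xe j)), hEo j⟩ (hEc j)
  haveI : ∀ i, FiniteDimensional ℂ ((σ₀ i).IntertwiningMap (r.ρ.comp (P₀ i).subtype)) := fun i =>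
    finiteDimensional_intertwiningMap_of_trivial_on r.ρ (hUP₀ i) (σ₀ i) (hτ₀ i)
  haveI : ∀ j, FiniteDimensional ℂ ((σ₁ j).IntertwiningMap (r.ρ.comp (P₁ j).subtype)) := fun j =>
    finiteDimensional_intertwiningMap_of_trivial_on r.ρ (hUP₁ j) (σ₁ j) (hτ₁ j)
  -- the two BRIDGES (★ 57-B)
  have h0 := Representation.finrank_intertwiningMap_zeroChains_eq_sum (ρ := r.ρ) hτc hstab hρ U hUa hρ₀ xv idx₀ tr₀ hidx₀ hidx₀a htr₀ P₀ hP₀ σ₀ hσ₀ r.ρ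
  have h1 := Representation.finrank_intertwiningMap_oneChains_eq_sum (ρ := r.ρ) hτ₁c hstab hρ τ U hUa hσa hρ₁ xe idx₁ tr₁ hidx₁ hidx₁a htr₁ P₁ hP₁ σ₁ hσ₁ r.ρ
  -- `Hom_Γ(C₀(X), σ)` is finite-dimensional (★ 57-B's equivalence + ★ 45)
  haveI : FiniteDimensional ℂ (ρ₀.IntertwiningMap r.ρ) := by
    obtain ⟨eq, -⟩ := Representation.exists_equiv_directSum_cIndRep_zeroChains (ρ := r.ρ) hτc hstab hρ U hUa hρ₀ xv idx₀ tr₀ hidx₀ hidx₀a htr₀ P₀ hP₀ σ₀ hσ₀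
    haveI := Representation.finite_intertwiningMap_directSum_cIndRep P₀ σ₀ r.ρ hP₀o (fun i => Representation.isSmooth_of_coe_apply_eq hρ (hσ₀ i))
    exact Module.Finite.equiv (Literature.RepresentationTheory.Semisimple.Representation.IntertwiningMap.congrLeft eq r.ρ)
  -- the presentation of `σ` itself (★ F-gen2, GLUE B inside) and Schur (★ admissible Schur)
  obtain ⟨dC, ε, hdinj, hexact, hε⟩ :=
    Representation.exists_intertwiningMap_presentation_of_isIrreducible (ρ := r.ρ) hτc hτ₁c hT τ hσa U hUc hU6 hU7 hUa hρ hx₀ hρ₁ hρ₀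
  have hschur : ∀ T : r.ρ.IntertwiningMap r.ρ, ∃ c : ℂ, T.toLinearMap = c • LinearMap.id := fun T =>
    hadm.exists_eq_smul_id (hUo x₀) (hUc x₀) T.toLinearMap fun g => LinearMap.ext fun x => Representation.IntertwiningMap.isIntertwining _ _ T g x
  -- ★ EP-TRACE-ONE ED. 2 §4
  exact r.ρ.smoothTrace_epTwoFamilies_eq_one_of_smooth_presentation νQv hadm hρ (fun i => U (xv i)) P₀ σ₀ f₀ (fun i => hUo (xv i)) (fun i => hUc (xv i)) hP₀c hUP₀ hPU₀ hτ₀ hfP₀ hf0₀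
    (fun j => U (τ.head (xe j)) ⊔ U (τ.tail (xe j))) P₁ σ₁ f₁ hEo hEc hP₁c hUP₁ hPU₁ hτ₁ hfP₁ hf0₁
    ρ₁ ρ₀ dC ε (Representation.isSmooth_rep_zeroChains_univ hτc hstab U hUo Set.univ hρ₀) hdinj hexact hε h0 h1 hsplit hschur

/-- **EP-NORM-ONE AT THE DATUM at ANY RAMIFIED place (wild included; modulo the pseudo-coefficient binder `hpc`) — `⟨χ_σ, χ_σ⟩_e = 1`** (twin of ★
`innerG_char_self_eq_one_of_isPseudoCoeff_epTwoFamilies` ∕ ★ `…_of_neg` with the datum slot `(he : e(w∣v) ≠ 1) (hϖ)`, conclusion VERBATIM; HONEST RESIDUE: the WILD supplier of `hpc`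
is the wild twin of row 58 (58-W-W), not this file).  At a §12.5 datum `𝔇` on `(Gqs L v, H)` with ★ PCT-OUT's letters (`hμG : 𝔇.μG = νQv`, `hreg`, `hM1`, `hWIF`, `hC1 hC2 hC3 hL2`),
in the situation of §1: IF the Euler–Poincaré function `f_EP = Σ_i μ(P₀ i)⁻¹ f₀ i − Σ_j μ(P₁ j)⁻¹ f₁ j` is a pseudo-coefficient of `σ = IrrClass.mk r` (`hpc`), THEN
`𝔇.innerG (𝔇.char σ) (𝔇.char σ) = 1`: ★ PCT-OUT gives `Tr σ(f_EP) = ⟨χ_σ, χ_σ⟩_e`, and `Tr σ(f_EP) = 1` by §1.  NO `IsL2` ∕ `IsEllipticRep` antecedent.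
[cite: Rogawski1990, §12.6 Prop. 12.6.1 (a) p. 188; §12.6 p. 187] [cite: SchneiderStuhler1997, §III.4] -/
theorem innerG_char_self_eq_one_of_isPseudoCoeff_epTwoFamilies_of_ramificationIdx_ne_one
    (hns : ∀ w : PlacesOver L v, IsCMField.complexConj L • w.1 = w.1)
    (w : PlacesOver L v) (hw : IsCMField.complexConj L • w.1 = w.1) {ϖ : (w.1.adicCompletion L)}
    (he : v.asIdeal.ramificationIdx' w.1.asIdeal ≠ 1) (hϖ : Valued.v ϖ = WithZero.exp (-1 : ℤ))
    (eA : (Gqs L v) ≃ₜ* ↥(unitaryGroupOfForm (galAdicCompletionMap (L := L) (IsCMField.complexConj L) hw) ((StdForm.antidiagonal 3).over (w.1.adicCompletion L))))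
    {a : (Gqs L v) →* ((latticeGraph (galAdicCompletionMap (L := L) (IsCMField.complexConj L) hw) ϖ ((StdForm.antidiagonal 3).over (w.1.adicCompletion L))) ≃g (latticeGraph (galAdicCompletionMap (L := L) (IsCMField.complexConj L) hw) ϖ ((StdForm.antidiagonal 3).over (w.1.adicCompletion L))))} (ha : ∀ g, a g = latticeGraphIso (galAdicCompletionMap (L := L) (IsCMField.complexConj L) hw) ϖ ((StdForm.antidiagonal 3).over (w.1.adicCompletion L)) (eA g))
    [MeasurableSpace (Gqs L v)] [BorelSpace (Gqs L v)]
    [∀ γ : Gqs L v, MeasurableSpace (Gqs L v ⧸ Subgroup.centralizer ({γ} : Set (Gqs L v)))] [MeasurableSpace (Gqs L v ⧸ Subgroup.center (Gqs L v))]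
    {H : Type} [Group H] [TopologicalSpace H] [IsTopologicalGroup H] [MeasurableSpace H]
    (νQv : Measure (Gqs L v)) [νQv.IsHaarMeasure] [νQv.IsMulRightInvariant]
    -- the §12.5 datum and ★ PCT-OUT's letters
    (𝔇 : EllipticData (Gqs L v) H) (hμG : 𝔇.μG = νQv)
    (hreg : ∀ γ : Gqs L v, γ ∈ 𝔇.regG ↔ IsRegularElt (γ.val : GL (Fin 3) (UnitaryGroup.LocalRing L v)))
    (hM1 : ∀ π : IrrClass (Gqs L v), Measurable (𝔇.char π) ∧ LocallyIntegrable (𝔇.char π) 𝔇.μG ∧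
      (∀ x ∈ 𝔇.regG, ∀ᶠ y in 𝓝 x, 𝔇.char π y = 𝔇.char π x) ∧
      ∀ φ : Gqs L v → ℂ, IsLocSmooth φ → π.smoothTrace 𝔇.μG φ = ∫ x, φ x * 𝔇.char π x ∂𝔇.μG)
    (hWIF : 𝔇.WeylIntegrationFormula) (hC1 : 𝔇.EllCartanSubset) (hC2 : 𝔇.EllCartanAE) (hC3 : 𝔇.NonEllCartanAE) (hL2 : 𝔇.L2CharOnTorusAll)
    (τ : Orientation (latticeGraph (galAdicCompletionMap (L := L) (IsCMField.complexConj L) hw) ϖ ((StdForm.antidiagonal 3).over (w.1.adicCompletion L)))) (hτ : ∀ d, τ.tail d < τ.head d)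
    {e : ℕ} {U : {M : Submodule 𝒪[(w.1.adicCompletion L)] (Fin 3 → (w.1.adicCompletion L)) // IsVertex (galAdicCompletionMap (L := L) (IsCMField.complexConj L) hw) ϖ ((StdForm.antidiagonal 3).over (w.1.adicCompletion L)) M} → Subgroup (Gqs L v)}
    (hU : ∀ x g, g ∈ U x ↔ mapGL ((eA g : ↥(unitaryGroupOfForm (galAdicCompletionMap (L := L) (IsCMField.complexConj L) hw) ((StdForm.antidiagonal 3).over (w.1.adicCompletion L)))) : GL (Fin 3) (w.1.adicCompletion L)) x.1 = x.1 ∧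
      x.1.map ((Matrix.toLin' ((((eA g : ↥(unitaryGroupOfForm (galAdicCompletionMap (L := L) (IsCMField.complexConj L) hw) ((StdForm.antidiagonal 3).over (w.1.adicCompletion L)))) : GL (Fin 3) (w.1.adicCompletion L)) : Matrix (Fin 3) (Fin 3) (w.1.adicCompletion L)) - 1)).restrictScalars 𝒪[(w.1.adicCompletion L)]) ≤ scaleLattice (ϖ ^ (e + 1)) x.1)
    (r : SmoothIrrep (Gqs L v)) {x₀ : {M : Submodule 𝒪[(w.1.adicCompletion L)] (Fin 3 → (w.1.adicCompletion L)) // IsVertex (galAdicCompletionMap (L := L) (IsCMField.complexConj L) hw) ϖ ((StdForm.antidiagonal 3).over (w.1.adicCompletion L)) M}} (hx₀ : r.ρ.fixedPoints (U x₀) ≠ ⊥)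
    -- vertex orbit data (★ 57-B letters)
    {ι₀ : Type} [Fintype ι₀] [DecidableEq ι₀] (xv : ι₀ → {M : Submodule 𝒪[(w.1.adicCompletion L)] (Fin 3 → (w.1.adicCompletion L)) // IsVertex (galAdicCompletionMap (L := L) (IsCMField.complexConj L) hw) ϖ ((StdForm.antidiagonal 3).over (w.1.adicCompletion L)) M}) (idx₀ : {M : Submodule 𝒪[(w.1.adicCompletion L)] (Fin 3 → (w.1.adicCompletion L)) // IsVertex (galAdicCompletionMap (L := L) (IsCMField.complexConj L) hw) ϖ ((StdForm.antidiagonal 3).over (w.1.adicCompletion L)) M} → ι₀) (tr₀ : {M : Submodule 𝒪[(w.1.adicCompletion L)] (Fin 3 → (w.1.adicCompletion L)) // IsVertex (galAdicCompletionMap (L := L) (IsCMField.complexConj L) hw) ϖ ((StdForm.antidiagonal 3).over (w.1.adicCompletion L)) M} → Gqs L v)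
    (hidx₀ : ∀ i, idx₀ (xv i) = i) (hidx₀a : ∀ (g : Gqs L v) (x : {M : Submodule 𝒪[(w.1.adicCompletion L)] (Fin 3 → (w.1.adicCompletion L)) // IsVertex (galAdicCompletionMap (L := L) (IsCMField.complexConj L) hw) ϖ ((StdForm.antidiagonal 3).over (w.1.adicCompletion L)) M}), idx₀ (a g x) = idx₀ x) (htr₀ : ∀ x, a (tr₀ x) (xv (idx₀ x)) = x)
    (P₀ : ι₀ → Subgroup (Gqs L v)) (hP₀ : ∀ i g, g ∈ P₀ i ↔ a g (xv i) = xv i)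
    (σ₀ : ∀ i, Representation ℂ ↥(P₀ i) ↥(r.ρ.fixedPoints (U (xv i))))
    (hσ₀ : ∀ (i : ι₀) (p : ↥(P₀ i)) (x : ↥(r.ρ.fixedPoints (U (xv i)))), ((σ₀ i p x : ↥(r.ρ.fixedPoints (U (xv i)))) : r.V) = r.ρ (p : Gqs L v) (x : r.V))
    -- edge orbit data (★ 57-B letters)
    {ι₁ : Type} [Fintype ι₁] [DecidableEq ι₁] (xe : ι₁ → (latticeGraph (galAdicCompletionMap (L := L) (IsCMField.complexConj L) hw) ϖ ((StdForm.antidiagonal 3).over (w.1.adicCompletion L))).edgeSet) (idx₁ : (latticeGraph (galAdicCompletionMap (L := L) (IsCMField.complexConj L) hw) ϖ ((StdForm.antidiagonal 3).over (w.1.adicCompletion L))).edgeSet → ι₁) (tr₁ : (latticeGraph (galAdicCompletionMap (L := L) (IsCMField.complexConj L) hw) ϖ ((StdForm.antidiagonal 3).over (w.1.adicCompletion L))).edgeSet → Gqs L v)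
    (hidx₁ : ∀ j, idx₁ (xe j) = j) (hidx₁a : ∀ (g : Gqs L v) (d : (latticeGraph (galAdicCompletionMap (L := L) (IsCMField.complexConj L) hw) ϖ ((StdForm.antidiagonal 3).over (w.1.adicCompletion L))).edgeSet), idx₁ ((a g).mapEdgeSet d) = idx₁ d)
    (htr₁ : ∀ d : (latticeGraph (galAdicCompletionMap (L := L) (IsCMField.complexConj L) hw) ϖ ((StdForm.antidiagonal 3).over (w.1.adicCompletion L))).edgeSet, (a (tr₁ d)).mapEdgeSet (xe (idx₁ d)) = d)
    (P₁ : ι₁ → Subgroup (Gqs L v)) (hP₁ : ∀ j g, g ∈ P₁ j ↔ (a g).mapEdgeSet (xe j) = xe j)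
    (σ₁ : ∀ j, Representation ℂ ↥(P₁ j) ↥(r.ρ.fixedPoints (U (τ.head (xe j)) ⊔ U (τ.tail (xe j)))))
    (hσ₁ : ∀ (j : ι₁) (p : ↥(P₁ j)) (x : ↥(r.ρ.fixedPoints (U (τ.head (xe j)) ⊔ U (τ.tail (xe j))))),
      ((σ₁ j p x : ↥(r.ρ.fixedPoints (U (τ.head (xe j)) ⊔ U (τ.tail (xe j))))) : r.V) = r.ρ (p : Gqs L v) (x : r.V))
    -- the `K`-type pieces (★ 42 letters)
    {f₀ : ι₀ → Gqs L v → ℂ} (hfP₀ : ∀ i (g : Gqs L v) (hg : g ∈ P₀ i), f₀ i g = (σ₀ i).character ⟨g, hg⟩⁻¹) (hf0₀ : ∀ i, ∀ g ∉ P₀ i, f₀ i g = 0)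
    {f₁ : ι₁ → Gqs L v → ℂ} (hfP₁ : ∀ j (g : Gqs L v) (hg : g ∈ P₁ j), f₁ j g = (σ₁ j).character ⟨g, hg⟩⁻¹) (hf0₁ : ∀ j, ∀ g ∉ P₁ j, f₁ j g = 0)
    -- every SMOOTH self-extension of `σ` splits (★ 40″ ∕ ★ 46″ at the families)
    (hsplit : ∀ (E : Type) [AddCommGroup E] [Module ℂ E] (ρE : Representation ℂ (Gqs L v) E), ρE.IsSmooth →
      ∀ (i : r.ρ.IntertwiningMap ρE) (p : ρE.IntertwiningMap r.ρ), Function.Injective i → LinearMap.ker p.toLinearMap = LinearMap.range i.toLinearMap →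
        Function.Surjective p → ∃ s : r.ρ.IntertwiningMap ρE, p.comp s = Representation.IntertwiningMap.id r.ρ)
    -- row 58's witnessed head: the EP function IS a pseudo-coefficient of `σ`
    (hpc : 𝔇.IsPseudoCoeff (IrrClass.mk r) ((∑ i, ((νQv.real (P₀ i : Set (Gqs L v)) : ℂ))⁻¹ • f₀ i) - ∑ j, ((νQv.real (P₁ j : Set (Gqs L v)) : ℂ))⁻¹ • f₁ j)) :
    𝔇.innerG (𝔇.char (IrrClass.mk r)) (𝔇.char (IrrClass.mk r)) = 1 := by
  have hPCT := F0P3cStCharTSPctOut.pseudoCoeffTrace_Gqs L v hns νQv 𝔇 hμG hreg hM1 hWIF hC1 hC2 hC3 hL2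
  rw [← hPCT (IrrClass.mk r) (IrrClass.mk r) _ hpc, hμG, IrrClass.smoothTrace_mk]
  exact smoothTrace_epTwoFamilies_eq_one_at_datum_of_ramificationIdx_ne_one L v hns w hw he hϖ eA ha νQv τ hτ hU r hx₀ xv idx₀ tr₀ hidx₀ hidx₀a htr₀ P₀ hP₀ σ₀ hσ₀
    xe idx₁ tr₁ hidx₁ hidx₁a htr₁ P₁ hP₁ σ₁ hσ₁ hfP₀ hf0₀ hfP₁ hf0₁ hsplit

end Head

end Summit.HodgeConjecture.HodgeConjecture.Cruxes.H413.K2E3EPTraceOneAtDatumWild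

end
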